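import Mathlib.NumberTheory.Chebyshev
import Mathlib.Data.Nat.Choose.Factorization
import Mathlib.Data.Nat.Factorial.Basic
import Mathlib.Data.Nat.Totient
import Mathlib.Analysis.Complex.ExponentialBounds
import Mathlib.Algebra.Order.Ring.Pow
import HarnessLib

/-!
# Elementary Mertens-type bounds and the totient lower bound `φ(n)/n ≫ 1/log log n`

Trunk T-ANT (`NumberTheory/LFunctions`). Fully proved, explicit-constant forms of the upper
halves of Mertens' first and second theorems, obtained from Chebyshev's bound `θ(x) ≤ x log 4`
(Mathlib: `Chebyshev.theta_le_log4_mul_x`) and Legendre's formula for `n!`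
(Mathlib: `Nat.factorization_factorial`), and their classical consequence for Euler's totient
function used by Shor (1997, §5: "`φ(r)/r > δ / log log r` for some constant `δ`", citing
Hardy–Wright, Thm. 328):

* `sum_log_div_prime_le` : `∑_{p ≤ n} (log p)/p ≤ log n + log 4` (Mertens I, upper half;
  proof: `log n! = ∑_{p ≤ n} v_p(n!) log p ≥ ∑_{p ≤ n} (⌊n/p⌋) log p`, `log n! ≤ n log n`,
  `⌊n/p⌋ ≥ n/p - 1` and `θ(n) ≤ n log 4`);
* `sum_mul_nonneg_of_partialSums` : Abel's inequality (partial summation against a nonnegative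
  non-increasing weight preserves inequalities between partial sums);
* `sum_inv_prime_le` : `∑_{p ≤ N} 1/p ≤ log log N + 4` for `N ≥ 2` (Mertens II, upper half, by
  partial summation from Mertens I with the weight `1/log`, the comparison sequence
  `log k - log (k-1)` and the telescoping bound `(log k - log(k-1))/log k ≤ log log k - log log(k-1)`);
* `exp_neg_div_log_le_prod_one_sub_inv` : `∏_{p ≤ N} (1 - 1/p) ≥ e^{-5}/log N` for `N ≥ 2`
  (Mertens III, lower half up to the constant, via `1 - 1/p ≥ exp(-1/(p-1))` and
  `∑ 1/(p(p-1)) ≤ 1`);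
* `totient_div_self_ge` : `φ(n)/n ≥ e^{-5} / (2 log log n)` for `n ≥ 3^9` (split the prime
  divisors of `n` at `y = log n`: the small ones contribute at least `∏_{p ≤ y}(1 - 1/p)`, the at
  most `log n / log y` large ones at least `1 - 1/log y ≥ 1/2` by Bernoulli's inequality);
* `exists_lt_totient_div_self` : `∃ δ > 0, ∀ r ≥ 3, δ / log log r < φ(r)/r` — the statement used
  by Shor, `Literature.Computability.Cryptography.Shor1997_totient_lower_bound` (discharged from this in
  `Literature/Computability/Cryptography/ShorProofs.lean`).

The constants (`log 4`, `4`, `e^{-5}`, `1/2`, `3^9`) are crude but explicit; the true asymptotics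
(Mertens 1874: `∑_{p ≤ x} 1/p = log log x + B + O(1/log x)`,
`∏_{p ≤ x} (1 - 1/p) ~ e^{-γ}/log x`; Landau: `liminf φ(n) log log n / n = e^{-γ}`,
Hardy–Wright Thm. 328) are not needed for the application and are not claimed.

## References

* G. H. Hardy, E. M. Wright, *An Introduction to the Theory of Numbers*, 6th ed., OUP 2008:
  Thm. 421 (§22.5, partial summation), Thm. 424–425 (§22.6, `∑_{p ≤ x} log p / p = log x + O(1)`),
  Thm. 427 (§22.7, `∑_{p ≤ x} 1/p = log log x + B₁ + o(1)`), Thm. 429 (§22.8, Mertens' product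
  theorem), Thm. 328 (§18.4, `liminf φ(n) log log n / n = e^{-γ}`), §22.2 (`θ(x) = O(x)`); book
  pp. 460–466 (PDF pp. 270–273 of the held copy).
* F. Mertens, *Ein Beitrag zur analytischen Zahlentheorie*, J. reine angew. Math. 78 (1874) 46–62.
* P. W. Shor, SIAM J. Comput. 26 (1997), §5 (use of `φ(r)/r > δ/log log r`).

## Mathlib

Used: `Nat.primesLE` (`Nat.mem_primesLE`), `Chebyshev.theta` with `Chebyshev.theta_le_log4_mul_x`,
`Chebyshev.theta_eq_sum_primesLE_log`, `Nat.factorization_factorial` (Legendre),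
`Real.log_nat_eq_sum_factorization`, `Nat.factorial_le_pow`, `Nat.Prime.dvd_factorial`,
`Nat.totient_eq_mul_prod_factors` (Euler's product formula over `ℚ`), `Nat.prod_primeFactors_dvd`,
`one_add_mul_le_pow` (Bernoulli), `Real.log_le_sub_one_of_pos`, `Real.one_sub_inv_le_log_of_pos`,
`Real.add_one_le_exp`, `Real.exp_one_lt_d9`, `Real.log_two_gt_d9`,
`Finset.prod_le_prod_of_subset_of_le_one`. Mathlib has Chebyshev's bounds
(`Mathlib.NumberTheory.Chebyshev`) and the divergence of `∑ 1/p`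
(`Mathlib.NumberTheory.SumPrimeReciprocals`) but no Mertens-type upper bounds and no lower
bound for `φ(n)/n` (searched: `Mertens`, `sum_inv_prime`, `totient` + `log`).
-/

noncomputable section

namespace Literature.NumberTheory.LFunctions.MertensBound

open Nat hiding log
open Finset Real

/-! ### Mertens' first theorem, upper half -/

/-- Legendre: `∑_{p ≤ n} ⌊n/p⌋ log p ≤ log n!` (each `p^{⌊n/p⌋}` divides `n!`, i.e.
`⌊n/p⌋ ≤ v_p(n!) = ∑_{i ≥ 1} ⌊n/p^i⌋`, and `log n! = ∑_p v_p(n!) log p`).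
[cite: HardyWright2008, §22.6 (proof of Thm 424, book p. 460)] -/
theorem sum_div_mul_log_le_log_factorial (n : ℕ) :
    ∑ p ∈ primesLE n, ((n / p : ℕ) : ℝ) * Real.log p ≤ Real.log (n)! := by
  rw [Real.log_nat_eq_sum_factorization (n)!, Finsupp.sum, Nat.support_factorization]
  have hsub : primesLE n ⊆ (n)!.primeFactors := by
    intro p hp
    rw [Nat.mem_primesLE] at hp
    exact Nat.mem_primeFactors.mpr ⟨hp.2, (Nat.Prime.dvd_factorial hp.2).mpr hp.1,
      Nat.factorial_ne_zero n⟩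
  calc ∑ p ∈ primesLE n, ((n / p : ℕ) : ℝ) * Real.log p
      ≤ ∑ p ∈ primesLE n, ((n)!.factorization p : ℝ) * Real.log p := by
        refine sum_le_sum fun p hp => ?_
        have hpr := (Nat.mem_primesLE.mp hp).2
        refine mul_le_mul_of_nonneg_right ?_ (Real.log_nonneg (by exact_mod_cast hpr.one_lt.le))
        rcases Nat.eq_zero_or_pos n with rfl | hn
        · simp
        · rw [Nat.factorization_factorial hpr (b := n + 1) (Nat.lt_succ_of_le (Nat.log_le_self p n))]
          have h1 : (1 : ℕ) ∈ Ico 1 (n + 1) := by simp; omega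
          have := Finset.single_le_sum (f := fun i => n / p ^ i) (fun i _ => Nat.zero_le _) h1
          simp only [pow_one] at this
          exact_mod_cast this
    _ ≤ ∑ p ∈ (n)!.primeFactors, ((n)!.factorization p : ℝ) * Real.log p := by
        refine sum_le_sum_of_subset_of_nonneg hsub fun p hp _ => ?_
        exact mul_nonneg (Nat.cast_nonneg _)
          (Real.log_nonneg (by exact_mod_cast (Nat.prime_of_mem_primeFactors hp).one_lt.le))

/-- **Mertens' first theorem, upper half, explicit** (Mertens 1874; Hardy–Wright Thm 425:
`∑_{p ≤ x} log p / p = log x + O(1)`): for every `n`, `∑_{p ≤ n} (log p)/p ≤ log n + log 4`.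
Proof: `n ∑_{p ≤ n} log p / p ≤ ∑_{p ≤ n} (⌊n/p⌋ + 1) log p ≤ log n! + θ(n) ≤ n log n + n log 4`
(Chebyshev's `θ(n) ≤ n log 4`, `n! ≤ n^n`). [cite: HardyWright2008, Thm 425 (§22.6, book p. 461)] -/
theorem sum_log_div_prime_le (n : ℕ) :
    ∑ p ∈ primesLE n, Real.log p / p ≤ Real.log n + Real.log 4 := by
  rcases Nat.eq_zero_or_pos n with rfl | hn
  · have : primesLE 0 = ∅ := by decide
    rw [this, sum_empty, Nat.cast_zero, Real.log_zero, zero_add]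
    exact Real.log_nonneg (by norm_num)
  have hn' : (0 : ℝ) < n := by exact_mod_cast hn
  -- multiply through by `n`
  refine le_of_mul_le_mul_left ?_ hn'
  rw [mul_sum]
  have hθ : ∑ p ∈ primesLE n, Real.log p ≤ Real.log 4 * n := by
    rw [← Chebyshev.theta_eq_sum_primesLE_log]
    exact Chebyshev.theta_le_log4_mul_x hn'.le
  have hfact : Real.log (n)! ≤ n * Real.log n := by
    rw [← Real.log_pow]
    exact Real.log_le_log (by exact_mod_cast Nat.factorial_pos n)
      (by exact_mod_cast Nat.factorial_le_pow n)
  calc ∑ p ∈ primesLE n, (n : ℝ) * (Real.log p / p)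
      ≤ ∑ p ∈ primesLE n, (((n / p : ℕ) : ℝ) * Real.log p + Real.log p) := by
        refine sum_le_sum fun p hp => ?_
        have hpr := (Nat.mem_primesLE.mp hp).2
        have hp0 : (0 : ℝ) < p := by exact_mod_cast hpr.pos
        have hlog : 0 ≤ Real.log p := Real.log_nonneg (by exact_mod_cast hpr.one_lt.le)
        have hdiv : (n : ℝ) ≤ ((n / p : ℕ) + 1 : ℝ) * p := by
          have h1 : n ≤ (n / p + 1) * p := by
            have := Nat.div_add_mod n p
            have := Nat.mod_lt n hpr.pos
            rw [add_mul, one_mul]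
            nlinarith
          exact_mod_cast h1
        calc (n : ℝ) * (Real.log p / p) = (n : ℝ) / p * Real.log p := by ring
          _ ≤ ((n / p : ℕ) + 1 : ℝ) * Real.log p := by
              refine mul_le_mul_of_nonneg_right ?_ hlog
              rwa [div_le_iff₀ hp0]
          _ = ((n / p : ℕ) : ℝ) * Real.log p + Real.log p := by ring
    _ = ∑ p ∈ primesLE n, ((n / p : ℕ) : ℝ) * Real.log p + ∑ p ∈ primesLE n, Real.log p :=
        sum_add_distrib
    _ ≤ Real.log (n)! + Real.log 4 * n := add_le_add (sum_div_mul_log_le_log_factorial n) hθ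
    _ ≤ n * Real.log n + Real.log 4 * n := by linarith
    _ = n * (Real.log n + Real.log 4) := by ring

/-! ### Abel's inequality -/

/-- **Abel's inequality** (partial summation): if all partial sums `∑_{k<n} d_k` (`n ≤ N`) are
nonnegative and the weights `w_k ≥ 0` are non-increasing, then `∑_{k<N} d_k w_k ≥ 0`. (Apply
with `d = b - a` to compare `∑ a_k w_k ≤ ∑ b_k w_k` from `∑_{k<n} a_k ≤ ∑_{k<n} b_k`.)
[cite: HardyWright2008, Thm 421 (§22.5, (22.5.1))] -/
theorem sum_mul_nonneg_of_partialSums {d w : ℕ → ℝ} {N : ℕ}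
    (hD : ∀ n ≤ N, 0 ≤ ∑ k ∈ range n, d k) (hw0 : ∀ k, 0 ≤ w k)
    (hw : ∀ k, w (k + 1) ≤ w k) : 0 ≤ ∑ k ∈ range N, d k * w k := by
  -- the stronger `(∑_{k<N} d_k) w_{N-1} ≤ ∑_{k<N} d_k w_k`, by induction
  suffices h : (∑ k ∈ range N, d k) * w (N - 1) ≤ ∑ k ∈ range N, d k * w k from
    le_trans (mul_nonneg (hD N le_rfl) (hw0 _)) h
  induction N with
  | zero => simp
  | succ N ih =>
    have ih' := ih fun n hn => hD n (Nat.le_succ_of_le hn)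
    rw [sum_range_succ, sum_range_succ, Nat.add_sub_cancel, add_mul]
    have hmono : w N ≤ w (N - 1) := by
      cases N with
      | zero => exact le_rfl
      | succ M => exact hw M
    have h1 : (∑ k ∈ range N, d k) * w N ≤ (∑ k ∈ range N, d k) * w (N - 1) :=
      mul_le_mul_of_nonneg_left hmono (hD N (Nat.le_succ N))
    linarith

/-! ### Mertens' second theorem, upper half -/

/-- The telescoping comparison `(log k - log (k-1)) / log k ≤ log log k - log log (k-1)` for
`k ≥ 3` (concavity of `log`: `log x ≤ x - 1` at `x = log(k-1)/log k`). [folklore] -/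
theorem sub_log_div_log_le (k : ℕ) (hk : 3 ≤ k) :
    (Real.log k - Real.log (k - 1)) / Real.log k ≤
      Real.log (Real.log k) - Real.log (Real.log (k - 1)) := by
  have hk' : (3 : ℝ) ≤ k := by exact_mod_cast hk
  have h1 : 0 < Real.log (k - 1) := Real.log_pos (by linarith)
  have h2 : 0 < Real.log k := Real.log_pos (by linarith)
  have h := Real.log_le_sub_one_of_pos (div_pos h1 h2)
  rw [Real.log_div h1.ne' h2.ne'] at h
  have h3 : (Real.log k - Real.log (k - 1)) / Real.log k = 1 - Real.log (k - 1) / Real.log k := by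
    field_simp
  rw [h3]
  linarith

/-- **Mertens' second theorem, upper half, explicit** (Mertens 1874; Hardy–Wright Thm 427:
`∑_{p ≤ x} 1/p = log log x + B₁ + o(1)`): for `N ≥ 2`, `∑_{p ≤ N} 1/p ≤ log log N + 4`. Proof by partial summation (Abel's inequality
`sum_mul_nonneg_of_partialSums`) from `sum_log_div_prime_le` with the weight `1/log k`,
comparing with the sequence `log 4, 0, log 2, log 3 - log 2, …` whose partial sums are
`log (k-1) + log 4`, and telescoping `sub_log_div_log_le`; the printed constant is Mertens'
`B₁ = 0.2614…` (`+ o(1)`), not needed here. [cite: HardyWright2008, Thm 427 (§22.7, book p. 464)] -/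
theorem sum_inv_prime_le (N : ℕ) (hN : 2 ≤ N) :
    ∑ p ∈ primesLE N, (1 : ℝ) / p ≤ Real.log (Real.log N) + 4 := by
  -- the three sequences
  set a : ℕ → ℝ := fun k => if k.Prime then Real.log k / k else 0 with ha
  set b : ℕ → ℝ := fun k => if k = 0 then Real.log 4 else Real.log k - Real.log (k - 1) with hb
  set w : ℕ → ℝ := fun k => 1 / Real.log (max k 2 : ℕ) with hw
  have hlog2 : 0 < Real.log 2 := Real.log_pos one_lt_two
  have hwpos : ∀ k, 0 < w k := fun k =>
    one_div_pos.mpr (Real.log_pos (by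
      have : (2 : ℕ) ≤ max k 2 := le_max_right _ _
      exact_mod_cast lt_of_lt_of_le one_lt_two this))
  have hwanti : ∀ k, w (k + 1) ≤ w k := fun k => by
    refine one_div_le_one_div_of_le (Real.log_pos ?_) (Real.log_le_log ?_ ?_)
    · exact_mod_cast (show (1 : ℕ) < max k 2 from lt_of_lt_of_le one_lt_two (le_max_right _ _))
    · exact_mod_cast (show (0 : ℕ) < max k 2 from lt_of_lt_of_le two_pos (le_max_right _ _))
    · exact_mod_cast (show max k 2 ≤ max (k + 1) 2 from max_le_max (Nat.le_succ k) le_rfl)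
  -- (i) the sum of `1/p` as `∑ a_k w_k`
  have hlhs : ∑ p ∈ primesLE N, (1 : ℝ) / p = ∑ k ∈ range (N + 1), a k * w k := by
    rw [Nat.primesLE_eq_filter_range, sum_filter]
    refine sum_congr rfl fun k _ => ?_
    split_ifs with hk
    · have hk2 : max k 2 = k := max_eq_left hk.two_le
      simp only [ha, hw, if_pos hk, hk2]
      have : Real.log k ≠ 0 := (Real.log_pos (by exact_mod_cast hk.one_lt)).ne'
      field_simp
    · simp [ha, hk]
  -- (ii) partial sums of `a`
  have hA : ∀ m, ∑ k ∈ range (m + 1), a k = ∑ p ∈ primesLE m, Real.log p / p := by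
    intro m
    rw [Nat.primesLE_eq_filter_range, sum_filter]
  -- (iii) partial sums of `b`
  have hB : ∀ m, ∑ k ∈ range (m + 1), b k = Real.log 4 + Real.log m := by
    intro m
    induction m with
    | zero => simp [hb]
    | succ m ih =>
      rw [sum_range_succ, ih]
      simp only [hb, Nat.cast_succ, add_sub_cancel_right, Nat.succ_ne_zero, if_false]
      ring
  -- (iv) Abel's inequality
  have hD : ∀ n ≤ N + 1, 0 ≤ ∑ k ∈ range n, (b k - a k) := by
    intro n _
    cases n with
    | zero => simp
    | succ m =>
      rw [sum_sub_distrib, hA, hB, sub_nonneg, add_comm]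
      exact sum_log_div_prime_le m
  have habel := sum_mul_nonneg_of_partialSums hD (fun k => (hwpos k).le) hwanti
  have hab : ∑ k ∈ range (N + 1), a k * w k ≤ ∑ k ∈ range (N + 1), b k * w k := by
    have : ∑ k ∈ range (N + 1), (b k - a k) * w k =
        ∑ k ∈ range (N + 1), b k * w k - ∑ k ∈ range (N + 1), a k * w k := by
      rw [← sum_sub_distrib]; exact sum_congr rfl fun k _ => by ring
    linarith
  -- (v) the comparison sum: `∑_{k ≤ N} b_k w_k ≤ 3 + log log N - log log 2`
  have hbw : ∀ n, 2 ≤ n → ∑ k ∈ range (n + 1), b k * w k ≤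
      3 + Real.log (Real.log n) - Real.log (Real.log 2) := by
    intro n hn
    induction n, hn using Nat.le_induction with
    | base =>
      -- `b₀ w₀ + b₁ w₁ + b₂ w₂ = log 4 / log 2 + 0 + 1 = 3`
      have h4 : Real.log 4 = 2 * Real.log 2 := by
        rw [show (4 : ℝ) = 2 ^ 2 by norm_num, Real.log_pow]; norm_num
      simp only [sum_range_succ, sum_range_zero, hb, hw, h4]
      norm_num
    | succ n hn ih =>
      rw [sum_range_succ]
      have hk3 : 3 ≤ n + 1 := by omega
      have hstep := sub_log_div_log_le (n + 1) hk3
      have hbn : b (n + 1) * w (n + 1) =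
          (Real.log (n + 1 : ℕ) - Real.log ((n + 1 : ℕ) - 1)) / Real.log (n + 1 : ℕ) := by
        have hmax : max (n + 1) 2 = n + 1 := max_eq_left (by omega)
        simp only [hb, hw, Nat.succ_ne_zero, if_false, hmax]
        ring
      rw [hbn]
      have hcast : ((n + 1 : ℕ) : ℝ) - 1 = n := by push_cast; ring
      rw [hcast] at hstep ⊢
      linarith
  -- (vi) `-log log 2 ≤ 1`
  have hll2 : -1 ≤ Real.log (Real.log 2) := by
    have h : Real.exp (-1) < Real.log 2 := by
      linarith [Real.log_two_gt_d9, Real.exp_neg_one_lt_d9]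
    exact ((Real.lt_log_iff_exp_lt hlog2).mpr h).le
  rw [hlhs]
  linarith [hbw N hN]

/-! ### Mertens' product theorem, lower half up to the constant -/

/-- Telescoping: `∑_{2 ≤ k ≤ n} 1/(k(k-1)) = 1 - 1/n` for `n ≥ 1`. [folklore] -/
theorem sum_Ico_inv_mul_pred (n : ℕ) (hn : 1 ≤ n) :
    ∑ k ∈ Ico 2 (n + 1), (1 : ℝ) / (k * (k - 1)) = 1 - 1 / n := by
  induction n, hn using Nat.le_induction with
  | base => simp
  | succ n hn ih =>
    rw [Finset.sum_Ico_succ_top (by omega), ih]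
    have hn0 : (n : ℝ) ≠ 0 := by exact_mod_cast (show n ≠ 0 by omega)
    have hn1 : (n : ℝ) + 1 ≠ 0 := by positivity
    have hc : ((n + 1 : ℕ) : ℝ) = (n : ℝ) + 1 := by push_cast; ring
    rw [hc, add_sub_cancel_right]
    field_simp
    ring

/-- `∑_{p ≤ N} 1/(p (p-1)) ≤ 1` (compare with the telescoping sum over all `2 ≤ k ≤ N`).
[folklore] -/
theorem sum_inv_prime_mul_pred_le_one (N : ℕ) :
    ∑ p ∈ primesLE N, (1 : ℝ) / (p * (p - 1)) ≤ 1 := by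
  rcases Nat.eq_zero_or_pos N with rfl | hN
  · simp [show primesLE 0 = ∅ by decide]
  have hsub : primesLE N ⊆ Ico 2 (N + 1) := by
    intro p hp
    rw [Nat.mem_primesLE] at hp
    rw [mem_Ico]
    exact ⟨hp.2.two_le, Nat.lt_succ_of_le hp.1⟩
  calc ∑ p ∈ primesLE N, (1 : ℝ) / (p * (p - 1))
      ≤ ∑ k ∈ Ico 2 (N + 1), (1 : ℝ) / (k * (k - 1)) := by
        refine sum_le_sum_of_subset_of_nonneg hsub fun k hk _ => ?_
        have hk2 : (2 : ℝ) ≤ k := by exact_mod_cast (mem_Ico.mp hk).1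
        have : (0 : ℝ) < k * (k - 1) := mul_pos (by linarith) (by linarith)
        positivity
    _ = 1 - 1 / N := sum_Ico_inv_mul_pred N hN
    _ ≤ 1 := by
        have : (0 : ℝ) ≤ 1 / N := by positivity
        linarith

/-- For `p ≥ 2`, `1 - 1/p ≥ exp (-1/(p-1))` (from `log t ≥ 1 - 1/t` at `t = 1 - 1/p`).
[folklore] -/
theorem exp_neg_inv_pred_le (p : ℕ) (hp : 2 ≤ p) :
    Real.exp (-(1 / ((p : ℝ) - 1))) ≤ 1 - 1 / (p : ℝ) := by
  have hp2 : (2 : ℝ) ≤ p := by exact_mod_cast hp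
  have hp0 : (p : ℝ) ≠ 0 := by positivity
  have hp1 : (p : ℝ) - 1 ≠ 0 := by
    have : (0 : ℝ) < p - 1 := by linarith
    exact this.ne'
  have ht : 0 < 1 - 1 / (p : ℝ) := by
    have : 1 / (p : ℝ) ≤ 1 / 2 := one_div_le_one_div_of_le two_pos hp2
    linarith
  have h := Real.one_sub_inv_le_log_of_pos ht
  have heq : 1 - (1 - 1 / (p : ℝ))⁻¹ = -(1 / ((p : ℝ) - 1)) := by
    field_simp
    ring
  rw [heq] at h
  calc Real.exp (-(1 / ((p : ℝ) - 1))) ≤ Real.exp (Real.log (1 - 1 / (p : ℝ))) :=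
        Real.exp_le_exp.mpr h
    _ = 1 - 1 / (p : ℝ) := Real.exp_log ht

/-- **Mertens' product theorem, lower half up to the constant** (Mertens 1874; Hardy–Wright
Thm 429 gives `∏_{p ≤ x} (1 - 1/p) ~ e^{-γ}/log x`): for `N ≥ 2`,
`∏_{p ≤ N} (1 - 1/p) ≥ e^{-5} / log N`. Proof: `1 - 1/p ≥ exp(-1/(p-1))`,
`∑ 1/(p-1) = ∑ 1/p + ∑ 1/(p(p-1)) ≤ (log log N + 4) + 1`. [cite: HardyWright2008, Thm 429 (§22.8)] -/
theorem exp_neg_div_log_le_prod_one_sub_inv (N : ℕ) (hN : 2 ≤ N) :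
    Real.exp (-5) / Real.log N ≤ ∏ p ∈ primesLE N, (1 - 1 / (p : ℝ)) := by
  have hN' : (2 : ℝ) ≤ N := by exact_mod_cast hN
  have hlogN : 0 < Real.log N := Real.log_pos (by linarith)
  -- `∑ 1/(p-1) ≤ log log N + 5`
  have hsum : ∑ p ∈ primesLE N, 1 / ((p : ℝ) - 1) ≤ Real.log (Real.log N) + 5 := by
    have hsplit : ∑ p ∈ primesLE N, 1 / ((p : ℝ) - 1) =
        ∑ p ∈ primesLE N, (1 : ℝ) / p + ∑ p ∈ primesLE N, (1 : ℝ) / (p * (p - 1)) := by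
      rw [← sum_add_distrib]
      refine sum_congr rfl fun p hp => ?_
      have hp2 : (2 : ℝ) ≤ p := by exact_mod_cast (Nat.mem_primesLE.mp hp).2.two_le
      have hp0 : (p : ℝ) ≠ 0 := by positivity
      have hp1 : (p : ℝ) - 1 ≠ 0 := (show (0 : ℝ) < p - 1 by linarith).ne'
      field_simp
      ring
    rw [hsplit]
    linarith [sum_inv_prime_le N hN, sum_inv_prime_mul_pred_le_one N]
  calc Real.exp (-5) / Real.log N = Real.exp (-(Real.log (Real.log N) + 5)) := by
        rw [neg_add, Real.exp_add, Real.exp_neg (Real.log (Real.log N)), Real.exp_log hlogN]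
        ring
    _ ≤ Real.exp (-∑ p ∈ primesLE N, 1 / ((p : ℝ) - 1)) :=
        Real.exp_le_exp.mpr (neg_le_neg hsum)
    _ = ∏ p ∈ primesLE N, Real.exp (-(1 / ((p : ℝ) - 1))) := by
        rw [← sum_neg_distrib, Real.exp_sum]
    _ ≤ ∏ p ∈ primesLE N, (1 - 1 / (p : ℝ)) :=
        prod_le_prod (fun p _ => (Real.exp_pos _).le)
          fun p hp => exp_neg_inv_pred_le p (Nat.mem_primesLE.mp hp).2.two_le

/-! ### The totient lower bound -/

/-- Euler's product formula over `ℝ`: `φ(n) = n ∏_{p ∣ n} (1 - 1/p)` (Mathlib's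
`Nat.totient_eq_mul_prod_factors`, cast from `ℚ`). [folklore] -/
theorem totient_eq_mul_prod_one_sub_inv (n : ℕ) :
    (φ n : ℝ) = n * ∏ p ∈ n.primeFactors, (1 - 1 / (p : ℝ)) := by
  have h := congrArg (fun q : ℚ => (q : ℝ)) (Nat.totient_eq_mul_prod_factors n)
  simp only [Rat.cast_natCast, Rat.cast_mul, Rat.cast_prod, Rat.cast_sub, Rat.cast_one,
    Rat.cast_inv] at h
  simpa only [one_div] using h

/-- `log 3 > 1` (`e < 3`). [folklore] -/
theorem one_lt_log_three : 1 < Real.log 3 :=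
  (Real.lt_log_iff_exp_lt (by norm_num)).mpr Real.exp_one_lt_three

/-- **The totient lower bound, explicit** (Landau 1903; Hardy–Wright Thm 328 gives the sharp
`liminf φ(n) log log n / n = e^{-γ}`): for `n ≥ 3^9`, `φ(n)/n ≥ e^{-5} / (2 log log n)`. Proof:
`φ(n)/n = ∏_{p ∣ n} (1 - 1/p)`; the primes `p ≤ y := log n` contribute at least
`∏_{p ≤ y} (1 - 1/p) ≥ e^{-5}/log y` (`exp_neg_div_log_le_prod_one_sub_inv`); there are
`m ≤ log n / log y` prime divisors `p > y` (their product is `≤ n`), contributing at least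
`(1 - 1/y)^m ≥ 1 - m/y ≥ 1 - 1/log y ≥ 1/2` (Bernoulli; `log y ≥ 2` as `y ≥ 9 > e²`).
[cite: HardyWright2008, Thm 328 (§18.4)] -/
theorem totient_div_self_ge (n : ℕ) (hn : 3 ^ 9 ≤ n) :
    Real.exp (-5) / (2 * Real.log (Real.log n)) ≤ (φ n : ℝ) / n := by
  have hn0' : 0 < n := lt_of_lt_of_le (by norm_num) hn
  have hn0 : (0 : ℝ) < n := by exact_mod_cast hn0'
  set y : ℝ := Real.log n with hy
  -- `y ≥ 9` and `log y ≥ 2`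
  have hy9 : 9 ≤ y := by
    have h1 : Real.log ((3 : ℕ) ^ 9 : ℕ) ≤ y := Real.log_le_log (by positivity) (by exact_mod_cast hn)
    have h2 : Real.log ((3 : ℕ) ^ 9 : ℕ) = 9 * Real.log 3 := by
      rw [Nat.cast_pow, Real.log_pow]; norm_num
    linarith [one_lt_log_three]
  have hy0 : 0 < y := by linarith
  have hlogy : 2 ≤ Real.log y := by
    have h1 : Real.log 9 ≤ Real.log y := Real.log_le_log (by norm_num) hy9
    have h2 : Real.log 9 = 2 * Real.log 3 := by
      rw [show (9 : ℝ) = 3 ^ 2 by norm_num, Real.log_pow]; norm_num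
    linarith [one_lt_log_three]
  have hlogy0 : 0 < Real.log y := by linarith
  -- Euler's product, split at `y`
  set f : ℕ → ℝ := fun p => 1 - 1 / (p : ℝ) with hf
  have hf01 : ∀ p : ℕ, 2 ≤ p → 0 ≤ f p ∧ f p ≤ 1 := by
    intro p hp
    have hp2 : (2 : ℝ) ≤ p := by exact_mod_cast hp
    have h1 : 0 ≤ 1 / (p : ℝ) := by positivity
    have h2 : 1 / (p : ℝ) ≤ 1 / 2 := one_div_le_one_div_of_le two_pos hp2
    exact ⟨by simp only [hf]; linarith, by simp only [hf]; linarith⟩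
  have hPF2 : ∀ p ∈ n.primeFactors, 2 ≤ p := fun p hp => (Nat.prime_of_mem_primeFactors hp).two_le
  rw [totient_eq_mul_prod_one_sub_inv, mul_div_cancel_left₀ _ hn0.ne',
    ← prod_filter_mul_prod_filter_not n.primeFactors (fun p : ℕ => (p : ℝ) ≤ y)]
  set S := n.primeFactors.filter (fun p : ℕ => (p : ℝ) ≤ y) with hS
  set L := n.primeFactors.filter (fun p : ℕ => ¬ (p : ℝ) ≤ y) with hL
  -- the small primes
  have hsmall : Real.exp (-5) / Real.log y ≤ ∏ p ∈ S, f p := by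
    have hfl2 : 2 ≤ ⌊y⌋₊ := Nat.le_floor (by push_cast; linarith)
    have hfl0 : (0 : ℝ) < ⌊y⌋₊ := by exact_mod_cast lt_of_lt_of_le two_pos hfl2
    have hsub : S ⊆ primesLE ⌊y⌋₊ := by
      intro p hp
      rw [hS, mem_filter] at hp
      exact Nat.mem_primesLE.mpr ⟨Nat.le_floor hp.2, Nat.prime_of_mem_primeFactors hp.1⟩
    calc Real.exp (-5) / Real.log y ≤ Real.exp (-5) / Real.log ⌊y⌋₊ :=
          div_le_div_of_nonneg_left (Real.exp_pos _).le (Real.log_pos (by exact_mod_cast hfl2))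
            (Real.log_le_log hfl0 (Nat.floor_le hy0.le))
      _ ≤ ∏ p ∈ primesLE ⌊y⌋₊, f p := exp_neg_div_log_le_prod_one_sub_inv _ hfl2
      _ ≤ ∏ p ∈ S, f p :=
          prod_le_prod_of_subset_of_le_one hsub
            (fun p hp => (hf01 p (Nat.mem_primesLE.mp hp).2.two_le).1)
            (fun p hp _ => (hf01 p (Nat.mem_primesLE.mp hp).2.two_le).2)
  -- the large primes: at most `y / log y ≤ y / 2` of them
  have hcard : (L.card : ℝ) ≤ y / 2 := by
    have h1 : y ^ L.card ≤ ∏ p ∈ L, (p : ℝ) := by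
      rw [← prod_const]
      exact prod_le_prod (fun _ _ => hy0.le) fun p hp => (lt_of_not_ge (mem_filter.mp hp).2).le
    have h2 : ∏ p ∈ L, (p : ℝ) ≤ ∏ p ∈ n.primeFactors, (p : ℝ) :=
      prod_le_prod_of_subset_of_one_le (filter_subset _ _) (fun _ _ => Nat.cast_nonneg _)
        fun p hp _ => by
          have : (2 : ℝ) ≤ p := by exact_mod_cast hPF2 p hp
          linarith
    have h3 : ∏ p ∈ n.primeFactors, (p : ℝ) ≤ n := by
      have := Nat.le_of_dvd hn0' (Nat.prod_primeFactors_dvd n)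
      rw [← Nat.cast_prod]
      exact_mod_cast this
    have h4 : (L.card : ℝ) * Real.log y ≤ y := by
      rw [← Real.log_pow]
      exact Real.log_le_log (pow_pos hy0 _) (h1.trans (h2.trans h3))
    rw [le_div_iff₀ two_pos]
    nlinarith
  have hlarge : 1 / 2 ≤ ∏ p ∈ L, f p := by
    have h1 : (1 - 1 / y) ^ L.card ≤ ∏ p ∈ L, f p := by
      rw [← prod_const]
      refine prod_le_prod (fun _ _ => ?_) fun p hp => ?_
      · have : 1 / y ≤ 1 / 9 := one_div_le_one_div_of_le (by norm_num) hy9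
        linarith
      · have hyp : y < p := lt_of_not_ge (mem_filter.mp hp).2
        have : 1 / (p : ℝ) ≤ 1 / y := one_div_le_one_div_of_le hy0 hyp.le
        simp only [hf]
        linarith
    have h2 : 1 - L.card * (1 / y) ≤ (1 - 1 / y) ^ L.card := by
      have h := one_add_mul_le_pow (a := -(1 / y)) (by
        have : 1 / y ≤ 1 / 9 := one_div_le_one_div_of_le (by norm_num) hy9
        have : 0 ≤ 1 / y := by positivity
        linarith) L.card
      calc 1 - L.card * (1 / y) = 1 + L.card * (-(1 / y)) := by ring
        _ ≤ (1 + -(1 / y)) ^ L.card := h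
        _ = (1 - 1 / y) ^ L.card := by ring
    have h3 : (L.card : ℝ) * (1 / y) ≤ 1 / 2 := by
      rw [← div_eq_mul_one_div, div_le_iff₀ hy0]
      linarith
    linarith
  -- combine
  have hS0 : 0 ≤ ∏ p ∈ S, f p :=
    prod_nonneg fun p hp => (hf01 p (hPF2 p (mem_filter.mp hp).1)).1
  calc Real.exp (-5) / (2 * Real.log (Real.log n))
      = Real.exp (-5) / Real.log y * (1 / 2) := by rw [← hy]; field_simp
    _ ≤ (∏ p ∈ S, f p) * ∏ p ∈ L, f p :=
        mul_le_mul hsmall hlarge (by norm_num) hS0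

/-- **The totient lower bound in Shor's form** (Shor 1997, §5: "`φ(r)/r > δ / log log r` for
some constant `δ`", from Hardy–Wright Thm 328): there is `δ > 0` with `δ / log log r < φ(r)/r`
for every `r ≥ 3`. (`r ≥ 3^9`: `totient_div_self_ge`; `3 ≤ r < 3^9`: `φ(r) ≥ 1` and
`log log r ≥ log log 3 > 0`.) [cite: HardyWright2008, Thm 328 (§18.4); as used in Shor1997 §5] -/
theorem exists_lt_totient_div_self :
    ∃ δ : ℝ, 0 < δ ∧ ∀ r : ℕ, 3 ≤ r → δ / Real.log (Real.log r) < (φ r : ℝ) / r := by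
  set N₀ : ℕ := 3 ^ 9 with hN₀
  have hN₀0 : (0 : ℝ) < N₀ := by rw [hN₀]; positivity
  have hll3 : 0 < Real.log (Real.log 3) := Real.log_pos one_lt_log_three
  refine ⟨min (Real.exp (-5) / 4) (Real.log (Real.log 3) / (2 * N₀)),
    lt_min (by positivity) (by positivity), fun r hr => ?_⟩
  have hr3 : (3 : ℝ) ≤ r := by exact_mod_cast hr
  have hr0 : (0 : ℝ) < r := by linarith
  have hllr : Real.log (Real.log 3) ≤ Real.log (Real.log r) :=
    Real.log_le_log (by linarith [one_lt_log_three]) (Real.log_le_log (by norm_num) hr3)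
  have hllr0 : 0 < Real.log (Real.log r) := lt_of_lt_of_le hll3 hllr
  have hφ : 1 / (r : ℝ) ≤ (φ r : ℝ) / r := by
    refine div_le_div_of_nonneg_right ?_ hr0.le
    exact_mod_cast Nat.totient_pos.mpr (by exact_mod_cast hr0 : 0 < r)
  rcases lt_or_ge r N₀ with h | h
  · -- small `r`
    have hr2 : (r : ℝ) < 2 * N₀ := by
      have : (r : ℝ) < N₀ := by exact_mod_cast h
      linarith
    calc min (Real.exp (-5) / 4) (Real.log (Real.log 3) / (2 * N₀)) / Real.log (Real.log r)
        ≤ Real.log (Real.log 3) / (2 * N₀) / Real.log (Real.log r) :=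
          div_le_div_of_nonneg_right (min_le_right _ _) hllr0.le
      _ ≤ Real.log (Real.log 3) / (2 * N₀) / Real.log (Real.log 3) :=
          div_le_div_of_nonneg_left (by positivity) hll3 hllr
      _ = 1 / (2 * N₀) := by field_simp
      _ < 1 / r := one_div_lt_one_div_of_lt hr0 hr2
      _ ≤ (φ r : ℝ) / r := hφ
  · -- large `r`
    calc min (Real.exp (-5) / 4) (Real.log (Real.log 3) / (2 * N₀)) / Real.log (Real.log r)
        ≤ Real.exp (-5) / 4 / Real.log (Real.log r) :=
          div_le_div_of_nonneg_right (min_le_left _ _) hllr0.le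
      _ < Real.exp (-5) / (2 * Real.log (Real.log r)) := by
          rw [div_div]
          exact div_lt_div_of_pos_left (Real.exp_pos _) (by positivity) (by nlinarith)
      _ ≤ (φ r : ℝ) / r := totient_div_self_ge r h

end Literature.NumberTheory.LFunctions.MertensBound

end
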